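import Mathlib

/-!
# Moment and gap bounds (helpers for stub `stub_scaleRegularity`)

Real-variable estimates used by the scale-regularity stub of line `self-energy-pick-inversion`
(crux stmt-CriticalPhenomena-4799):

* Hausdorff moment sequences `μ_j = ∫ t^j dτ` of a finite measure `τ` carried by `[0,1]`:
  `0 ≤ μ_{j+1} ≤ μ_j` and the difference bound `μ_{l+u} − μ_{l+u+1} ≤ μ_l/(u+1)`
  (from `(u+1) t^u (1−t) ≤ 1 − t^{u+1} ≤ 1` on `[0,1]`, proved inline);
* iterated one-step gap: `M(n+1) ≤ r M(n)` (`n ≥ 1`) gives `M(n) ≤ r^{n−m} M(m)` for `n ≥ m ≥ 1`;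
* the one-dimensional exponential integral `∫_{[-π,π]} e^{-β|t|} dt ≤ 2/β` and the pointwise
  splitting `e^{-b‖k‖} ≤ Π_j e^{-(b/2)|k_j|}` (sup norm on `ℝ²`) feeding the square integrals of the
  profile-family file.

This file depends on Mathlib only.

Pure theorem file, no definitions. Sources: folklore (Hausdorff moment problem, Widder 1941 ch. III;
elementary calculus).
-/

noncomputable section

namespace Summit.CriticalPhenomena.Ising3DConformalLimit.Cruxes.DirectCorrelationStableTail.SelfEnergyPickInversion

open MeasureTheory Filter Topology Real
open scoped BigOperators

/-! ### Hausdorff moment sequences -/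

/-- A measure that does not charge the complement of `[0,1]` lives on `[0,1]` almost everywhere. -/
theorem ae_mem_unitInterval {τ : Measure ℝ} (hτ : τ (Set.Icc (0 : ℝ) 1)ᶜ = 0) :
    ∀ᵐ t ∂τ, 0 ≤ t ∧ t ≤ 1 := by
  rw [ae_iff]
  convert hτ using 2
  ext t
  simp [Set.mem_Icc]

/-- Monomials are integrable against a finite measure carried by `[0,1]`. -/
theorem integrable_pow_unitInterval {τ : Measure ℝ} [IsFiniteMeasure τ]
    (hτ : τ (Set.Icc (0 : ℝ) 1)ᶜ = 0) (j : ℕ) : Integrable (fun t : ℝ => t ^ j) τ :=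
  (integrable_const (1 : ℝ)).mono' (by fun_prop : Continuous fun t : ℝ => t ^ j).aestronglyMeasurable
    ((ae_mem_unitInterval hτ).mono fun t ht => by
      rw [Real.norm_eq_abs, abs_pow, abs_of_nonneg ht.1]
      exact pow_le_one₀ ht.1 ht.2)

/-- Hausdorff moments are nonnegative. -/
theorem moment_nonneg {τ : Measure ℝ} (hτ : τ (Set.Icc (0 : ℝ) 1)ᶜ = 0) (j : ℕ) :
    0 ≤ ∫ t, t ^ j ∂τ :=
  integral_nonneg_of_ae ((ae_mem_unitInterval hτ).mono fun _ ht => pow_nonneg ht.1 j)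

/-- Hausdorff moments are non-increasing: `μ_j ≤ μ_l` for `l ≤ j`. -/
theorem moment_anti {τ : Measure ℝ} [IsFiniteMeasure τ] (hτ : τ (Set.Icc (0 : ℝ) 1)ᶜ = 0)
    {l j : ℕ} (hlj : l ≤ j) : ∫ t, t ^ j ∂τ ≤ ∫ t, t ^ l ∂τ :=
  integral_mono_ae (integrable_pow_unitInterval hτ j) (integrable_pow_unitInterval hτ l)
    ((ae_mem_unitInterval hτ).mono fun _ ht => pow_le_pow_of_le_one ht.1 ht.2 hlj)

/-- **Difference bound for Hausdorff moments**: `μ_{l+u} − μ_{l+u+1} ≤ μ_l / (u+1)`. -/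
theorem moment_sub_succ_le {τ : Measure ℝ} [IsFiniteMeasure τ] (hτ : τ (Set.Icc (0 : ℝ) 1)ᶜ = 0)
    (l u : ℕ) :
    ∫ t, t ^ (l + u) ∂τ - ∫ t, t ^ (l + u + 1) ∂τ ≤ (∫ t, t ^ l ∂τ) / (u + 1) := by
  rw [← integral_sub (integrable_pow_unitInterval hτ _) (integrable_pow_unitInterval hτ _),
    le_div_iff₀ (by positivity : (0 : ℝ) < u + 1), ← integral_mul_const]
  refine integral_mono_ae (((integrable_pow_unitInterval hτ _).sub
    (integrable_pow_unitInterval hτ _)).mul_const _) (integrable_pow_unitInterval hτ l)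
    ((ae_mem_unitInterval hτ).mono fun t ht => ?_)
  -- the elementary inequality `(u+1) t^u (1-t) ≤ 1 - t^(u+1) ≤ 1` on `[0,1]`
  have h : (u + 1 : ℝ) * (t ^ u * (1 - t)) ≤ 1 := by
    have hsum : (u + 1 : ℝ) * t ^ u ≤ ∑ i ∈ Finset.range (u + 1), t ^ i := by
      have h' : ∀ i ∈ Finset.range (u + 1), t ^ u ≤ t ^ i := fun i hi =>
        pow_le_pow_of_le_one ht.1 ht.2 (Nat.lt_succ_iff.mp (Finset.mem_range.mp hi))
      calc (u + 1 : ℝ) * t ^ u = ∑ _i ∈ Finset.range (u + 1), t ^ u := by simp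
        _ ≤ ∑ i ∈ Finset.range (u + 1), t ^ i := Finset.sum_le_sum h'
    calc (u + 1 : ℝ) * (t ^ u * (1 - t)) = ((u + 1 : ℝ) * t ^ u) * (1 - t) := by ring
      _ ≤ (∑ i ∈ Finset.range (u + 1), t ^ i) * (1 - t) :=
          mul_le_mul_of_nonneg_right hsum (by linarith [ht.2])
      _ = 1 - t ^ (u + 1) := geom_sum_mul_neg t (u + 1)
      _ ≤ 1 := by linarith [pow_nonneg ht.1 (u + 1)]
  calc (t ^ (l + u) - t ^ (l + u + 1)) * (u + 1 : ℝ) = t ^ l * ((u + 1 : ℝ) * (t ^ u * (1 - t))) := by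
        ring
    _ ≤ t ^ l * 1 := mul_le_mul_of_nonneg_left h (pow_nonneg ht.1 l)
    _ = t ^ l := mul_one _

/-! ### Iterated one-step gap -/

/-- Iterating `M(n+1) ≤ r M(n)` (`n ≥ 1`, `r ≥ 0`): `M(m+d) ≤ r^d M(m)` for `m ≥ 1`. -/
theorem le_pow_mul_of_succ_le {M : ℕ → ℝ} {r : ℝ} (hr : 0 ≤ r)
    (h : ∀ n, 1 ≤ n → M (n + 1) ≤ r * M n) {m : ℕ} (hm : 1 ≤ m) (d : ℕ) :
    M (m + d) ≤ r ^ d * M m := by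
  induction d with
  | zero => simp
  | succ d ih =>
    calc M (m + (d + 1)) = M (m + d + 1) := by rw [Nat.add_assoc]
      _ ≤ r * M (m + d) := h _ (by omega)
      _ ≤ r * (r ^ d * M m) := mul_le_mul_of_nonneg_left ih hr
      _ = r ^ (d + 1) * M m := by ring

/-! ### One-dimensional exponential integral -/

/-- `∫_{[-π,π]} e^{-β|t|} dt ≤ 2/β` for `β > 0`. -/
theorem integral_Icc_exp_neg_mul_abs_le {β : ℝ} (hβ : 0 < β) :
    ∫ t in Set.Icc (-π) π, Real.exp (-(β * |t|)) ≤ 2 / β := by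
  -- integrability of `e^{-β|t|}` on `ℝ`: glue the two half-lines
  have hint : Integrable (fun t : ℝ => Real.exp (-(β * |t|))) := by
    have h1 : IntegrableOn (fun t : ℝ => Real.exp (-(β * |t|))) (Set.Ioi 0) := by
      refine (exp_neg_integrableOn_Ioi 0 hβ).congr_fun (fun t ht => ?_) measurableSet_Ioi
      simp only [abs_of_pos (Set.mem_Ioi.1 ht), neg_mul]
    have h2 : IntegrableOn (fun t : ℝ => Real.exp (-(β * |t|))) (Set.Iic 0) := by
      refine (integrableOn_exp_mul_Iic hβ 0).congr_fun (fun t ht => ?_) measurableSet_Iic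
      simp only [abs_of_nonpos (Set.mem_Iic.1 ht)]; ring_nf
    have := h2.union h1
    rwa [Set.Iic_union_Ioi, integrableOn_univ] at this
  calc ∫ t in Set.Icc (-π) π, Real.exp (-(β * |t|))
      ≤ ∫ t, Real.exp (-(β * |t|)) :=
        setIntegral_le_integral hint (ae_of_all _ fun _ => (exp_pos _).le)
    _ = 2 * ∫ t in Set.Ioi (0 : ℝ), Real.exp (-β * t) := by
        rw [← integral_comp_abs (f := fun t => Real.exp (-β * t))]
        simp [neg_mul]
    _ = 2 / β := by
        rw [integral_exp_mul_Ioi (by linarith : -β < 0) 0]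
        field_simp
        simp

/-- Pointwise: `e^{-b‖k‖} ≤ ∏_j e^{-(b/2)|k_j|}` on `ℝ²` (sup norm), for `b ≥ 0`. -/
theorem exp_neg_mul_norm_le_prod {b : ℝ} (hb : 0 ≤ b) (k : Fin 2 → ℝ) :
    Real.exp (-(b * ‖k‖)) ≤ ∏ j, Real.exp (-(b / 2 * |k j|)) := by
  rw [← Real.exp_sum, Real.exp_le_exp, Fin.sum_univ_two]
  have h0 : |k 0| ≤ ‖k‖ := by simpa [Real.norm_eq_abs] using norm_le_pi_norm k 0
  have h1 : |k 1| ≤ ‖k‖ := by simpa [Real.norm_eq_abs] using norm_le_pi_norm k 1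
  nlinarith

/-! ### Registered helper sub-goal -/

/-- **Registered helper sub-goal `stub_scaleRegularity_auxMoment`** of stub `stub_scaleRegularity`
(line `self-energy-pick-inversion`, crux stmt-CriticalPhenomena-4799): the HAUSDORFF MOMENT DIFFERENCE
BOUND — for a finite measure `τ` carried by `[0,1]`, `∫ t^{l+u} dτ − ∫ t^{l+u+1} dτ ≤ (∫ t^l dτ)/(u+1)`
(this is what bounds the longitudinal differences of the slab profiles). -/
theorem stub_scaleRegularity_auxMoment :
    ∀ (τ : MeasureTheory.Measure ℝ), MeasureTheory.IsFiniteMeasure τ → τ (Set.Icc (0 : ℝ) 1)ᶜ = 0 →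
    ∀ l u : ℕ, ∫ t, t ^ (l + u) ∂τ - ∫ t, t ^ (l + u + 1) ∂τ ≤ (∫ t, t ^ l ∂τ) / (u + 1) :=
  fun _τ hfin hτ l u => by
    haveI := hfin
    exact moment_sub_succ_le hτ l u

end Summit.CriticalPhenomena.Ising3DConformalLimit.Cruxes.DirectCorrelationStableTail.SelfEnergyPickInversion

end
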